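import Mathlib
import HarnessLib

/-!
# `FemtoCurvatureSkewness` — stub `PerpPropagatorPos` of line `Sketch-ideator3` (crux stmt-QuantumFields-9365)

Positivity of the zero-mode-free transverse lattice propagator of the `(0,1)`-plaquette field on the `L⁴` torus at
the displacements `n e₂` and `n(e₃ − e₂)`, `1 ≤ n ≤ L/8`:
`∑_{k} w(k) cos(k·x) > 0`, `w(k) = (k̂₀² + k̂₁²)/(k̂₀² + k̂₁² + k̂₂² + k̂₃²)` (`w(0) = 0`), `k̂ᵢ² = 2 − 2cos(2πkᵢ/L)`.

Proof (all finite sums, Mathlib only; the file declares theorems only — the Green's function, the delta function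
and the character sums are written out as explicit finite sums): slice in `(k₀,k₁)`; for fixed mass
`μ = k̂₀² + k̂₁² > 0` the `(k₂,k₃)`-sum is `μ · G_μ(x)` with `G_μ(x) = ∑ cos(2π k·x/L)/(μ + k̂₂² + k̂₃²)` the
(`L²`-normalised) Yukawa Green's function of the 2-d discrete torus, viewed as an `L`-periodic function on `ℤ²`.
`G_μ` satisfies the lattice Helmholtz equation `(μ − Δ) G_μ = δ` (`helmholtz`: the eigen-relation
`cos(θ+φ) + cos(θ−φ) = 2cos φ cos θ` of `cos` under the 1-d lattice Laplacian), where
`δ(x) = ∑ cos(2π k·x/L) = Re χ(x₁)χ(x₂) ≥ 0` by character orthogonality (`chi_cases`: a geometric sum of `L`-th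
roots of unity is `0` or `L`) and `δ(L,L) = L² > 0`.  The minimum principle on the finite torus
(`torus_min_principle`: at a minimiser `x*`, `μ G(x*) ≥ δ(x*) ≥ 0`, and `G(x*) ≤ 0` would propagate along
`+e₁, +e₂` to the lattice point `(L,L)` where `δ > 0`) gives `G_μ > 0` everywhere (`green_pos`); the slices with
`μ = 0` contribute `0`, the slice `(k₀,k₁) = (1,0)` contributes `> 0` (`fourSum_pos`).
-/

noncomputable section

namespace Summit.QuantumFields.YangMills.Theorems.FemtoCurvatureSkewness

open Finset
open scoped BigOperators

namespace PerpPropagator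

/-! ## Elementary trigonometric facts -/

/-- The first Fourier mode is not a zero mode: `2 − 2cos(2π/L) > 0` for `L ≥ 2`. -/
theorem first_mode_pos (L : ℕ) (hL : 1 < L) : 0 < 2 - 2 * Real.cos (2 * Real.pi / L) := by
  have hLpos : (0 : ℝ) < L := by exact_mod_cast (lt_trans zero_lt_one hL)
  have hL1 : (1 : ℝ) < L := by exact_mod_cast hL
  have h1 : 0 < 2 * Real.pi / L := div_pos Real.two_pi_pos hLpos
  have h2 : 2 * Real.pi / L < 2 * Real.pi := div_lt_self Real.two_pi_pos hL1
  have hne : Real.cos (2 * Real.pi / L) ≠ 1 := fun h =>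
    h1.ne' ((Real.cos_eq_one_iff_of_lt_of_lt (by linarith) h2).mp h)
  have hlt := lt_of_le_of_ne (Real.cos_le_one (2 * Real.pi / L)) hne
  linarith

/-! ## Abstract lattice analysis on `ℤ²`: periodicity, Helmholtz equation, minimum principle -/

variable (L : ℕ)

/-- A trigonometric sum `G(y) = ∑ₚ cos(θₚ(y))/dₚ` whose phases shift by multiples of `2π` under `y ↦ y + L(s,t)`
is `L`-periodic in both coordinates. -/
theorem periodic_of_phases {ι : Type*} [Fintype ι] (θ : ι → ℤ × ℤ → ℝ) (d : ι → ℝ) (G : ℤ × ℤ → ℝ)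
    (hG : ∀ y, G y = ∑ p, Real.cos (θ p y) / d p)
    (hθ : ∀ (p : ι) (x : ℤ × ℤ) (s t : ℤ), ∃ z : ℤ, θ p (x.1 + L * s, x.2 + L * t) = θ p x + z * (2 * Real.pi))
    (x : ℤ × ℤ) (s t : ℤ) : G (x.1 + L * s, x.2 + L * t) = G x := by
  rw [hG, hG]
  refine Finset.sum_congr rfl fun p _ => ?_
  obtain ⟨z, hz⟩ := hθ p x s t
  rw [hz, Real.cos_add_int_mul_two_pi]

variable [NeZero L]

/-- **Lattice Helmholtz equation.** If the phases `θₚ` shift by `±φₚ` (`±ψₚ`) under the unit steps in the first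
(second) coordinate, then `G(y) = ∑ₚ cos(θₚ(y))/(μ + (2 − 2cos φₚ) + (2 − 2cos ψₚ))` satisfies
`μ G(x) − (ΔG)(x) = ∑ₚ cos(θₚ(x))`. -/
theorem helmholtz {ι : Type*} [Fintype ι] (μ : ℝ) (θ : ι → ℤ × ℤ → ℝ) (φ ψ : ι → ℝ) (G : ℤ × ℤ → ℝ)
    (hG : ∀ y, G y = ∑ p, Real.cos (θ p y) / (μ + (2 - 2 * Real.cos (φ p)) + (2 - 2 * Real.cos (ψ p))))
    (hd : ∀ p, μ + (2 - 2 * Real.cos (φ p)) + (2 - 2 * Real.cos (ψ p)) ≠ 0) (x : ℤ × ℤ)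
    (h1 : ∀ p, θ p (x.1 + 1, x.2) = θ p x + φ p) (h2 : ∀ p, θ p (x.1 - 1, x.2) = θ p x - φ p)
    (h3 : ∀ p, θ p (x.1, x.2 + 1) = θ p x + ψ p) (h4 : ∀ p, θ p (x.1, x.2 - 1) = θ p x - ψ p) :
    μ * G x + (4 * G x - G (x.1 + 1, x.2) - G (x.1 - 1, x.2) - G (x.1, x.2 + 1) - G (x.1, x.2 - 1)) =
      ∑ p, Real.cos (θ p x) := by
  simp only [hG]
  rw [Finset.mul_sum, Finset.mul_sum, ← Finset.sum_sub_distrib, ← Finset.sum_sub_distrib,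
    ← Finset.sum_sub_distrib, ← Finset.sum_sub_distrib, ← Finset.sum_add_distrib]
  refine Finset.sum_congr rfl fun p _ => ?_
  -- clear the common denominator, then use the eigen-relation of `cos` in each direction
  have key : ∀ c t₁ t₂ t₃ t₄ d : ℝ, d ≠ 0 → μ * c + (4 * c - t₁ - t₂ - t₃ - t₄) = c * d →
      μ * (c / d) + (4 * (c / d) - t₁ / d - t₂ / d - t₃ / d - t₄ / d) = c := by
    intro c t₁ t₂ t₃ t₄ d hd h
    field_simp
    linear_combination h
  refine key _ _ _ _ _ _ (hd p) ?_
  rw [h1, h2, h3, h4]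
  -- `cos(θ+φ) + cos(θ−φ) = 2cos φ cos θ`: `cos` is an eigenfunction of the 1-d lattice Laplacian
  have e : ∀ a b : ℝ, Real.cos (a + b) + Real.cos (a - b) = 2 * Real.cos b * Real.cos a := fun a b => by
    rw [Real.cos_add, Real.cos_sub]; ring
  linear_combination -e (θ p x) (φ p) - e (θ p x) (ψ p)

/-- A doubly `L`-periodic function on `ℤ²` attains its minimum, at a point of the fundamental box `[0,L)²`. -/
theorem periodic_exists_min (G : ℤ × ℤ → ℝ)
    (hper : ∀ (x : ℤ × ℤ) (s t : ℤ), G (x.1 + L * s, x.2 + L * t) = G x) :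
    ∃ q : ℕ × ℕ, q.1 < L ∧ q.2 < L ∧ ∀ y : ℤ × ℤ, G ((q.1 : ℤ), (q.2 : ℤ)) ≤ G y := by
  have hne : (Finset.range L ×ˢ Finset.range L).Nonempty :=
    (Finset.nonempty_range_iff.mpr (NeZero.ne L)).product (Finset.nonempty_range_iff.mpr (NeZero.ne L))
  obtain ⟨q, hq, hmin⟩ :=
    Finset.exists_min_image _ (fun q : ℕ × ℕ => G ((q.1 : ℤ), (q.2 : ℤ))) hne
  simp only [Finset.mem_product, Finset.mem_range] at hq
  refine ⟨q, hq.1, hq.2, fun y => ?_⟩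
  have hL0 : (L : ℤ) ≠ 0 := by exact_mod_cast NeZero.ne L
  have hLpos : (0 : ℤ) < L := by exact_mod_cast NeZero.pos L
  have h1 : (((y.1 % L).toNat : ℕ) : ℤ) = y.1 % L := Int.toNat_of_nonneg (Int.emod_nonneg _ hL0)
  have h2 : (((y.2 % L).toNat : ℕ) : ℤ) = y.2 % L := Int.toNat_of_nonneg (Int.emod_nonneg _ hL0)
  have key : G y = G (((y.1 % L).toNat : ℤ), ((y.2 % L).toNat : ℤ)) := by
    rw [← hper (((y.1 % L).toNat : ℤ), ((y.2 % L).toNat : ℤ)) (y.1 / L) (y.2 / L)]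
    simp only [h1, h2, Int.emod_add_mul_ediv, Prod.mk.eta]
  rw [key]
  exact hmin ((y.1 % L).toNat, (y.2 % L).toNat) (Finset.mem_product.mpr
    ⟨Finset.mem_range.mpr ((Int.toNat_lt_of_ne_zero (NeZero.ne L)).mpr (Int.emod_lt_of_pos _ hLpos)),
     Finset.mem_range.mpr ((Int.toNat_lt_of_ne_zero (NeZero.ne L)).mpr (Int.emod_lt_of_pos _ hLpos))⟩)

/-- **Minimum principle on the discrete torus.** A doubly `L`-periodic solution `G` of
`μ G − ΔG = δ` on `ℤ²` with `μ > 0`, `δ ≥ 0` and `δ(L,L) > 0` is everywhere positive: at a minimiser `x*`,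
`μ G(x*) ≥ δ(x*) ≥ 0`; if `G(x*) ≤ 0` then `δ(x*) = 0` and the neighbours of `x*` are minimisers as well, so
the whole lattice consists of minimisers with `δ = 0`, contradicting `δ(L,L) > 0`. -/
theorem torus_min_principle (μ : ℝ) (hμ : 0 < μ) (G δ : ℤ × ℤ → ℝ)
    (hper : ∀ (x : ℤ × ℤ) (s t : ℤ), G (x.1 + L * s, x.2 + L * t) = G x)
    (heq : ∀ x : ℤ × ℤ, μ * G x + (4 * G x - G (x.1 + 1, x.2) - G (x.1 - 1, x.2) - G (x.1, x.2 + 1)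
      - G (x.1, x.2 - 1)) = δ x)
    (hδ : ∀ x, 0 ≤ δ x) (hδL : 0 < δ ((L : ℤ), (L : ℤ))) (y : ℤ × ℤ) : 0 < G y := by
  obtain ⟨q, hq1, hq2, hmin⟩ := periodic_exists_min L G hper
  set m := G ((q.1 : ℤ), (q.2 : ℤ)) with hm
  refine lt_of_lt_of_le ?_ (hmin y)
  by_contra hle
  push Not at hle
  -- at a minimiser with non-positive value, `δ` vanishes and the `+e₁`, `+e₂` neighbours are minimisers too
  have step : ∀ x : ℤ × ℤ, G x = m → δ x = 0 ∧ G (x.1 + 1, x.2) = m ∧ G (x.1, x.2 + 1) = m := by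
    intro x hx
    have hE := heq x
    have hD := hδ x
    have n1 := hmin (x.1 + 1, x.2); have n2 := hmin (x.1 - 1, x.2)
    have n3 := hmin (x.1, x.2 + 1); have n4 := hmin (x.1, x.2 - 1)
    have hμm : μ * m ≤ 0 := mul_nonpos_of_nonneg_of_nonpos hμ.le hle
    rw [hx] at hE
    exact ⟨by linarith, by linarith, by linarith⟩
  have row : ∀ j : ℕ, G ((q.1 : ℤ) + j, (q.2 : ℤ)) = m := by
    intro j
    induction j with
    | zero => simp [hm]
    | succ j ih => have h := (step _ ih).2.1; push_cast; rw [← add_assoc]; exact h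
  have grid : ∀ j i : ℕ, G ((q.1 : ℤ) + j, (q.2 : ℤ) + i) = m := by
    intro j i
    induction i with
    | zero => simpa using row j
    | succ i ih => have h := (step _ ih).2.2; push_cast; rw [← add_assoc]; exact h
  have hD0 := (step _ (grid (L - q.1) (L - q.2))).1
  have e1 : ((q.1 : ℤ) + ((L - q.1 : ℕ) : ℤ)) = (L : ℤ) := by omega
  have e2 : ((q.2 : ℤ) + ((L - q.2 : ℕ) : ℤ)) = (L : ℤ) := by omega
  rw [e1, e2] at hD0
  linarith

/-! ## Character sums on `ZMod L` -/

/-- **Character orthogonality on `ZMod L`.** The character sum `χ(y) = ∑_{a : ZMod L} exp(2πi a y/L)`, a geometric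
sum of `L`-th roots of unity, is `0` or `L`. -/
theorem chi_cases (y : ℤ) :
    ∑ a : ZMod L, Complex.exp (((2 * Real.pi * ((a.val : ℝ) * (y : ℝ)) / L : ℝ) : ℂ) * Complex.I) = 0 ∨
    ∑ a : ZMod L, Complex.exp (((2 * Real.pi * ((a.val : ℝ) * (y : ℝ)) / L : ℝ) : ℂ) * Complex.I) = L := by
  set ω : ℂ := Complex.exp (((2 * Real.pi * (y : ℝ) / L : ℝ) : ℂ) * Complex.I) with hω
  have hterm : ∀ a : ZMod L,
      Complex.exp (((2 * Real.pi * ((a.val : ℝ) * (y : ℝ)) / L : ℝ) : ℂ) * Complex.I) = ω ^ a.val := by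
    intro a
    rw [hω, ← Complex.exp_nat_mul]
    congr 1
    push_cast
    ring
  simp_rw [hterm]
  -- re-index the sum over `ZMod L` by the representatives `0, …, L-1`
  rw [show ∑ a : ZMod L, ω ^ a.val = ∑ j ∈ Finset.range L, ω ^ j from
    Finset.sum_nbij' (fun a => a.val) (fun j => (j : ZMod L)) (fun a _ => Finset.mem_range.mpr (ZMod.val_lt a))
      (fun j _ => Finset.mem_univ _) (fun a _ => ZMod.natCast_zmod_val a)
      (fun j hj => ZMod.val_natCast_of_lt (Finset.mem_range.mp hj)) (fun a _ => rfl)]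
  have hL : (L : ℂ) ≠ 0 := Nat.cast_ne_zero.mpr (NeZero.ne L)
  have hωL : ω ^ L = 1 := by
    rw [hω, ← Complex.exp_nat_mul]
    have h : (L : ℂ) * ((((2 * Real.pi * (y : ℝ) / L : ℝ)) : ℂ) * Complex.I) =
        (y : ℂ) * (2 * Real.pi * Complex.I) := by
      push_cast
      field_simp
    rw [h]
    exact Complex.exp_int_mul_two_pi_mul_I y
  by_cases h1 : ω = 1
  · right; simp [h1]
  · left; rw [geom_sum_eq h1, hωL]; simp

/-- The 2-d character sum factorises: `δ(x) = ∑_{(a,b)} cos(2π(a x₁ + b x₂)/L) = Re (χ(x₁) χ(x₂))`. -/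
theorem delta_eq_re (x : ℤ × ℤ) :
    ∑ p : ZMod L × ZMod L, Real.cos (2 * Real.pi * ((p.1.val : ℝ) * (x.1 : ℝ) + (p.2.val : ℝ) * (x.2 : ℝ)) / L) =
      ((∑ a : ZMod L, Complex.exp (((2 * Real.pi * ((a.val : ℝ) * (x.1 : ℝ)) / L : ℝ) : ℂ) * Complex.I)) *
        ∑ a : ZMod L, Complex.exp (((2 * Real.pi * ((a.val : ℝ) * (x.2 : ℝ)) / L : ℝ) : ℂ) * Complex.I)).re := by
  rw [Fintype.sum_prod_type, Finset.sum_mul_sum, Complex.re_sum]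
  refine Finset.sum_congr rfl fun a _ => ?_
  rw [Complex.re_sum]
  refine Finset.sum_congr rfl fun b _ => ?_
  rw [← Complex.exp_add, ← Complex.exp_ofReal_mul_I_re]
  congr 2
  push_cast
  ring

/-- The periodic delta function `δ(x) = ∑_{(a,b)} cos(2π(a x₁ + b x₂)/L)` is non-negative on `ℤ²`. -/
theorem delta_nonneg (x : ℤ × ℤ) :
    0 ≤ ∑ p : ZMod L × ZMod L,
      Real.cos (2 * Real.pi * ((p.1.val : ℝ) * (x.1 : ℝ) + (p.2.val : ℝ) * (x.2 : ℝ)) / L) := by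
  rw [delta_eq_re]
  rcases chi_cases L x.1 with h1 | h1
  · rw [h1, zero_mul, Complex.zero_re]
  · rcases chi_cases L x.2 with h2 | h2
    · rw [h2, mul_zero, Complex.zero_re]
    · rw [h1, h2, ← Nat.cast_mul, Complex.natCast_re]
      positivity

/-- `δ(L, L) = L² > 0`: every character equals `1` at the lattice point `(L, L) ∈ L ℤ²`. -/
theorem delta_LL_pos :
    0 < ∑ p : ZMod L × ZMod L,
      Real.cos (2 * Real.pi * ((p.1.val : ℝ) * ((L : ℤ) : ℝ) + (p.2.val : ℝ) * ((L : ℤ) : ℝ)) / L) := by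
  have hL : (L : ℝ) ≠ 0 := Nat.cast_ne_zero.mpr (NeZero.ne L)
  have hLpos : (0 : ℝ) < L := by exact_mod_cast NeZero.pos L
  have h : ∀ p : ZMod L × ZMod L,
      Real.cos (2 * Real.pi * ((p.1.val : ℝ) * ((L : ℤ) : ℝ) + (p.2.val : ℝ) * ((L : ℤ) : ℝ)) / L) = 1 := by
    intro p
    have e : 2 * Real.pi * ((p.1.val : ℝ) * ((L : ℤ) : ℝ) + (p.2.val : ℝ) * ((L : ℤ) : ℝ)) / L =
        ((p.1.val + p.2.val : ℕ) : ℝ) * (2 * Real.pi) := by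
      push_cast
      field_simp
    rw [e, Real.cos_nat_mul_two_pi]
  simp only [h, Finset.sum_const, Finset.card_univ, Fintype.card_prod, ZMod.card, nsmul_eq_mul, mul_one,
    Nat.cast_mul]
  exact mul_pos hLpos hLpos

/-! ## The torus Yukawa Green's function and the sliced momentum sum -/

/-- **2-d torus Yukawa positivity.** For `μ > 0` the (`L²`-normalised) Green's function
`G_μ(y) = ∑_{(a,b)} cos(2π(a y₁ + b y₂)/L)/(μ + k̂²(a) + k̂²(b))` is positive at every site `y ∈ ℤ²`. -/
theorem green_pos (μ : ℝ) (hμ : 0 < μ) (y : ℤ × ℤ) :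
    0 < ∑ p : ZMod L × ZMod L,
      Real.cos (2 * Real.pi * ((p.1.val : ℝ) * (y.1 : ℝ) + (p.2.val : ℝ) * (y.2 : ℝ)) / L) /
        (μ + (2 - 2 * Real.cos (2 * Real.pi * (p.1.val : ℝ) / L)) +
          (2 - 2 * Real.cos (2 * Real.pi * (p.2.val : ℝ) / L))) := by
  have hLr : (L : ℝ) ≠ 0 := Nat.cast_ne_zero.mpr (NeZero.ne L)
  -- local abbreviations (theorem-local `let`s, transparent to `rfl`)
  let θ : ZMod L × ZMod L → ℤ × ℤ → ℝ := fun p y =>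
    2 * Real.pi * ((p.1.val : ℝ) * (y.1 : ℝ) + (p.2.val : ℝ) * (y.2 : ℝ)) / L
  let φ : ZMod L × ZMod L → ℝ := fun p => 2 * Real.pi * (p.1.val : ℝ) / L
  let ψ : ZMod L × ZMod L → ℝ := fun p => 2 * Real.pi * (p.2.val : ℝ) / L
  let G : ℤ × ℤ → ℝ := fun y =>
    ∑ p, Real.cos (θ p y) / (μ + (2 - 2 * Real.cos (φ p)) + (2 - 2 * Real.cos (ψ p)))
  let δ : ℤ × ℤ → ℝ := fun y => ∑ p, Real.cos (θ p y)
  have hd : ∀ p, μ + (2 - 2 * Real.cos (φ p)) + (2 - 2 * Real.cos (ψ p)) ≠ 0 := fun p => by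
    have ha := Real.cos_le_one (φ p)
    have hb := Real.cos_le_one (ψ p)
    exact ne_of_gt (by linarith)
  have hper : ∀ (x : ℤ × ℤ) (s t : ℤ), G (x.1 + L * s, x.2 + L * t) = G x :=
    periodic_of_phases L θ (fun p => μ + (2 - 2 * Real.cos (φ p)) + (2 - 2 * Real.cos (ψ p))) G
      (fun _ => rfl) (fun p x s t => ⟨p.1.val * s + p.2.val * t, by
        simp only [θ]
        push_cast
        field_simp
        ring⟩)
  have heq : ∀ x : ℤ × ℤ, μ * G x + (4 * G x - G (x.1 + 1, x.2) - G (x.1 - 1, x.2) - G (x.1, x.2 + 1)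
      - G (x.1, x.2 - 1)) = δ x := fun x =>
    helmholtz μ θ φ ψ G (fun _ => rfl) hd x
      (fun p => by simp only [θ, φ]; push_cast; ring) (fun p => by simp only [θ, φ]; push_cast; ring)
      (fun p => by simp only [θ, ψ]; push_cast; ring) (fun p => by simp only [θ, ψ]; push_cast; ring)
  have hδ : ∀ x, 0 ≤ δ x := delta_nonneg L
  have hδL : 0 < δ ((L : ℤ), (L : ℤ)) := delta_LL_pos L
  exact torus_min_principle L μ hμ G δ hper heq hδ hδL y

/-- The `(k₂,k₃)`-slice at fixed mass `μ = k̂₀² + k̂₁²` equals `μ · G_μ(x)`. -/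
theorem slice_eq (μ : ℝ) (x : ℤ × ℤ) :
    ∑ p : ZMod L × ZMod L, μ / (μ + (2 - 2 * Real.cos (2 * Real.pi * (p.1.val : ℝ) / L)) +
        (2 - 2 * Real.cos (2 * Real.pi * (p.2.val : ℝ) / L))) *
      Real.cos (2 * Real.pi * ((p.1.val : ℝ) * (x.1 : ℝ) + (p.2.val : ℝ) * (x.2 : ℝ)) / L) =
    μ * ∑ p : ZMod L × ZMod L,
      Real.cos (2 * Real.pi * ((p.1.val : ℝ) * (x.1 : ℝ) + (p.2.val : ℝ) * (x.2 : ℝ)) / L) /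
        (μ + (2 - 2 * Real.cos (2 * Real.pi * (p.1.val : ℝ) / L)) +
          (2 - 2 * Real.cos (2 * Real.pi * (p.2.val : ℝ) / L))) := by
  rw [Finset.mul_sum]
  refine Finset.sum_congr rfl fun p _ => ?_
  ring

/-- Each `(k₂,k₃)`-slice is non-negative (it vanishes for `μ = 0` and equals `μ G_μ(x) > 0` for `μ > 0`). -/
theorem slice_nonneg (μ : ℝ) (hμ : 0 ≤ μ) (x : ℤ × ℤ) :
    0 ≤ ∑ p : ZMod L × ZMod L, μ / (μ + (2 - 2 * Real.cos (2 * Real.pi * (p.1.val : ℝ) / L)) +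
        (2 - 2 * Real.cos (2 * Real.pi * (p.2.val : ℝ) / L))) *
      Real.cos (2 * Real.pi * ((p.1.val : ℝ) * (x.1 : ℝ) + (p.2.val : ℝ) * (x.2 : ℝ)) / L) := by
  rw [slice_eq]
  rcases hμ.eq_or_lt with h | h
  · rw [← h]
    simp
  · exact (mul_pos h (green_pos L μ h x)).le

/-- **The transverse propagator is positive.** Slicing the `4`-fold momentum sum in `(k₀,k₁)` (via the split
`k ↦ ((k 0, k 1), (k 2, k 3))`) exhibits it as a sum of the non-negative slices `μ G_μ(x)`, the slice
`(k₀,k₁) = (1,0)` being positive. -/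
theorem fourSum_pos (hL : 1 < L) (x : ℤ × ℤ) :
    0 < ∑ k : Fin 4 → ZMod L,
      ((2 - 2 * Real.cos (2 * Real.pi * ((k 0).val : ℝ) / L)) + (2 - 2 * Real.cos (2 * Real.pi * ((k 1).val : ℝ) / L))) /
        ((2 - 2 * Real.cos (2 * Real.pi * ((k 0).val : ℝ) / L)) + (2 - 2 * Real.cos (2 * Real.pi * ((k 1).val : ℝ) / L)) +
          (2 - 2 * Real.cos (2 * Real.pi * ((k 2).val : ℝ) / L)) + (2 - 2 * Real.cos (2 * Real.pi * ((k 3).val : ℝ) / L))) *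
        Real.cos (2 * Real.pi * (((k 2).val : ℝ) * (x.1 : ℝ) + ((k 3).val : ℝ) * (x.2 : ℝ)) / L) := by
  have hsum : ∑ k : Fin 4 → ZMod L,
      ((2 - 2 * Real.cos (2 * Real.pi * ((k 0).val : ℝ) / L)) + (2 - 2 * Real.cos (2 * Real.pi * ((k 1).val : ℝ) / L))) /
        ((2 - 2 * Real.cos (2 * Real.pi * ((k 0).val : ℝ) / L)) + (2 - 2 * Real.cos (2 * Real.pi * ((k 1).val : ℝ) / L)) +
          (2 - 2 * Real.cos (2 * Real.pi * ((k 2).val : ℝ) / L)) + (2 - 2 * Real.cos (2 * Real.pi * ((k 3).val : ℝ) / L))) *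
        Real.cos (2 * Real.pi * (((k 2).val : ℝ) * (x.1 : ℝ) + ((k 3).val : ℝ) * (x.2 : ℝ)) / L) =
      ∑ qp : (ZMod L × ZMod L) × (ZMod L × ZMod L),
        ((2 - 2 * Real.cos (2 * Real.pi * (qp.1.1.val : ℝ) / L)) + (2 - 2 * Real.cos (2 * Real.pi * (qp.1.2.val : ℝ) / L))) /
          ((2 - 2 * Real.cos (2 * Real.pi * (qp.1.1.val : ℝ) / L)) + (2 - 2 * Real.cos (2 * Real.pi * (qp.1.2.val : ℝ) / L)) +
            (2 - 2 * Real.cos (2 * Real.pi * (qp.2.1.val : ℝ) / L)) + (2 - 2 * Real.cos (2 * Real.pi * (qp.2.2.val : ℝ) / L))) *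
          Real.cos (2 * Real.pi * ((qp.2.1.val : ℝ) * (x.1 : ℝ) + (qp.2.2.val : ℝ) * (x.2 : ℝ)) / L) :=
    Fintype.sum_equiv
      (Equiv.mk (fun k : Fin 4 → ZMod L => ((k 0, k 1), (k 2, k 3)))
        (fun q : (ZMod L × ZMod L) × (ZMod L × ZMod L) => ![q.1.1, q.1.2, q.2.1, q.2.2])
        (fun k => by funext i; fin_cases i <;> rfl) (fun _ => rfl))
      _ _ (fun _ => rfl)
  rw [hsum, Fintype.sum_prod_type]
  dsimp only
  refine Finset.sum_pos' (fun q _ => slice_nonneg L _ (by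
      have ha := Real.cos_le_one (2 * Real.pi * (q.1.val : ℝ) / L)
      have hb := Real.cos_le_one (2 * Real.pi * (q.2.val : ℝ) / L)
      linarith) x)
    ⟨((1 : ZMod L), (0 : ZMod L)), Finset.mem_univ _, ?_⟩
  dsimp only
  have hμ : 0 < (2 - 2 * Real.cos (2 * Real.pi * ((1 : ZMod L).val : ℝ) / L)) +
      (2 - 2 * Real.cos (2 * Real.pi * ((0 : ZMod L).val : ℝ) / L)) := by
    rw [@ZMod.val_one L ⟨hL⟩, ZMod.val_zero, Nat.cast_one, Nat.cast_zero, mul_one, mul_zero, zero_div,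
      Real.cos_zero]
    have h := first_mode_pos L hL
    linarith
  rw [slice_eq]
  exact mul_pos hμ (green_pos L _ hμ x)

end PerpPropagator

/-- **Transverse torus propagator positivity** (stub `PerpPropagatorPos`, registered signature verbatim). -/
theorem PerpPropagatorPos :
  ∀ (L n : ℕ) [NeZero L], 1 ≤ n → 8 * n ≤ L →
    0 < ∑ k : Fin 4 → ZMod L,
        (if k = 0 then 0 else ((2 - 2 * Real.cos (2 * Real.pi * ((k 0).val : ℝ) / L)) + (2 - 2 * Real.cos (2 * Real.pi * ((k 1).val : ℝ) / L))) /
          ((2 - 2 * Real.cos (2 * Real.pi * ((k 0).val : ℝ) / L)) + (2 - 2 * Real.cos (2 * Real.pi * ((k 1).val : ℝ) / L)) +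
            (2 - 2 * Real.cos (2 * Real.pi * ((k 2).val : ℝ) / L)) + (2 - 2 * Real.cos (2 * Real.pi * ((k 3).val : ℝ) / L)))) *
          Real.cos (2 * Real.pi * ((k 2).val : ℝ) * n / L) ∧
    0 < ∑ k : Fin 4 → ZMod L,
        (if k = 0 then 0 else ((2 - 2 * Real.cos (2 * Real.pi * ((k 0).val : ℝ) / L)) + (2 - 2 * Real.cos (2 * Real.pi * ((k 1).val : ℝ) / L))) /
          ((2 - 2 * Real.cos (2 * Real.pi * ((k 0).val : ℝ) / L)) + (2 - 2 * Real.cos (2 * Real.pi * ((k 1).val : ℝ) / L)) +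
            (2 - 2 * Real.cos (2 * Real.pi * ((k 2).val : ℝ) / L)) + (2 - 2 * Real.cos (2 * Real.pi * ((k 3).val : ℝ) / L)))) *
          Real.cos (2 * Real.pi * (((k 3).val : ℝ) - ((k 2).val : ℝ)) * n / L) := by
  intro L n _ hn hnL
  have hL : 1 < L := by omega
  have main := fun x : ℤ × ℤ => PerpPropagator.fourSum_pos L hL x
  refine ⟨lt_of_lt_of_eq (main ((n : ℤ), 0)) (Finset.sum_congr rfl fun k _ => ?_),
    lt_of_lt_of_eq (main (-(n : ℤ), (n : ℤ))) (Finset.sum_congr rfl fun k _ => ?_)⟩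
  · by_cases hk : k = 0
    · subst hk
      simp
    · rw [if_neg hk]
      congr 2
      push_cast
      ring
  · by_cases hk : k = 0
    · subst hk
      simp
    · rw [if_neg hk]
      congr 2
      push_cast
      ring

end Summit.QuantumFields.YangMills.Theorems.FemtoCurvatureSkewness

end
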